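import Literature.Computability.QuantumComplexity.ForrelationThm25Asm
import HarnessLib

/-!
# Uniformity of the Hadamard-gadget family, II: registers and printing routines of the machine

Topic `Literature/Computability/QuantumComplexity`; second of the files proving that the compiled
post-selected IQP family `HGadget.Hop.gadgetFamily F` (`HadamardGadgetFamily.lean`; Bremner–Jozsa–
Shepherd 2011, proof of Thm. 1 with Def. 1: the description of the compiled circuit is computable in
polynomial time) is uniform. The token stream of `HadamardGadgetLexer.lean` is interpreted by a
structured stack program (`Com`, `StackPrograms.lean`), written — as the interpreter of
`ForrelationThm25Asm.lean`, whose generic routines `pushList`, `emitRep`, `incR`, `incLoop`,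
`clearFlag`, … are reused — against a record `St` of named registers. This file provides

* the registers `HGadget.Hop.Asm.R` and states `HGadget.Hop.Asm.St` (`regs`, `upd_*`, `init`);
* the printed texts: the doubled code, inside `encList`, of a `CZ`, a `T` and a `Z` gate of
  `iqpDiag` around the fourfold-repeated binary numerals of its wires (`czText`, `tText`, `zText`);
* the printing routines and their exact effects on states (`Runs`): `emitNum` (the fourfold numeral
  held in a list of registers — a position `i + 2^L s` is printed as the `L`-bit numeral of `i`
  followed by the numeral of `s`), `emitCZ`, `emitT`, `emitZ`; the fixed-width increment `incF`
  (the carry pass of `TokConv.ib`); the unary countdown loop on `cU` (`runs_loopCU`), `mkZeroF`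
  (an `L`-bit zero counter), and **the hop layer** `hopLayer` printing
  `CZ(pos s i, pos s' i)` for `i < N`.

## References

* M. J. Bremner, R. Jozsa, D. J. Shepherd, Proc. R. Soc. A 467 (2011) 459–472, Def. 1, Thm. 1.
* S. Arora, B. Barak, *Computational Complexity: A Modern Approach*, CUP 2009, §0.1, §1.3, §6.1.
* D. E. Knuth, *The Art of Computer Programming*, Vol. 2, 3rd ed. 1998, §4.3.1 (carry propagation).
* T. Nipkow, G. Klein, *Concrete Semantics with Isabelle/HOL*, Springer 2014, Ch. 7.
-/

namespace Literature.Computability.QuantumComplexity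

open _root_.Computability Complexity Complexity.Com Cryptography Thm25Lex
open Thm25Asm (pushList runs_pushList emitRep runs_emitRep incR runs_incR incLoop runs_incLoop clearFlag runs_clearFlag
  IsFlag isFlag_nil isFlag_true isFlag_flag)

namespace HGadget.Hop

namespace Asm

/-! ### Registers and states -/

/-- The registers of the machine: `inp` (input stream); `g1` (stream after the unary prefix); `g2` (stream after the numeral of `n`); `g` (token stream of the gate list); `nU` (unary `n`); `nB` (binary numeral of `n`); `n1B` (binary numeral of `n + 1`); `mU` (unary `m`); `NU` (unary `N = n + m`); `x` (binary counter for `N + 1`); `LU` (unary `L`); `lc` (countdown of the padding); `k1` (the numeral of `1`); `sB` (numeral of the stage `s`); `s1` (numeral of `s + 1`); `s2` (numeral of `s + 2`); `sfU` (unary `s_f + 1`); `wa` (wire accumulator); `w1` (first wire slot); `w2` (second wire slot); `f1` (slot flag); `iC` (canonical wire counter); `iF` (fixed-width wire counter); `cU` (unary loop countdown); `SU` (unary stride `2^L`); `t3` (scratch); `o` (reversed body); `res` (result); `pl` (unary `postLen`); `t` (scratch); `t2` (scratch); `fl` (carry flag). [folklore] -/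
inductive R
  | inp | g1 | g2 | g | nU | nB | n1B | mU | NU | x | LU | lc | k1 | sB | s1 | s2 | sfU | wa | w1 | w2 | f1 | iC | iF | cU | SU | t3 | o | res | pl | t | t2 | fl
  deriving DecidableEq, Fintype

/-- The contents of the registers, by name. [folklore] -/
structure St where
  /-- register `inp`: input stream -/
  inp : List Bool
  /-- register `g1`: stream after the unary prefix -/
  g1 : List Bool
  /-- register `g2`: stream after the numeral of `n` -/
  g2 : List Bool
  /-- register `g`: token stream of the gate list -/
  g : List Bool
  /-- register `nU`: unary `n` -/
  nU : List Bool
  /-- register `nB`: binary numeral of `n` -/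
  nB : List Bool
  /-- register `n1B`: binary numeral of `n + 1` -/
  n1B : List Bool
  /-- register `mU`: unary `m` -/
  mU : List Bool
  /-- register `NU`: unary `N = n + m` -/
  NU : List Bool
  /-- register `x`: binary counter for `N + 1` -/
  x : List Bool
  /-- register `LU`: unary `L` -/
  LU : List Bool
  /-- register `lc`: countdown of the padding -/
  lc : List Bool
  /-- register `k1`: the numeral of `1` -/
  k1 : List Bool
  /-- register `sB`: numeral of the stage `s` -/
  sB : List Bool
  /-- register `s1`: numeral of `s + 1` -/
  s1 : List Bool
  /-- register `s2`: numeral of `s + 2` -/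
  s2 : List Bool
  /-- register `sfU`: unary `s_f + 1` -/
  sfU : List Bool
  /-- register `wa`: wire accumulator -/
  wa : List Bool
  /-- register `w1`: first wire slot -/
  w1 : List Bool
  /-- register `w2`: second wire slot -/
  w2 : List Bool
  /-- register `f1`: slot flag -/
  f1 : List Bool
  /-- register `iC`: canonical wire counter -/
  iC : List Bool
  /-- register `iF`: fixed-width wire counter -/
  iF : List Bool
  /-- register `cU`: unary loop countdown -/
  cU : List Bool
  /-- register `SU`: unary stride `2^L` -/
  SU : List Bool
  /-- register `t3`: scratch -/
  t3 : List Bool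
  /-- register `o`: reversed body -/
  o : List Bool
  /-- register `res`: result -/
  res : List Bool
  /-- register `pl`: unary `postLen` -/
  pl : List Bool
  /-- register `t`: scratch -/
  t : List Bool
  /-- register `t2`: scratch -/
  t2 : List Bool
  /-- register `fl`: carry flag -/
  fl : List Bool

namespace St

/-- The register file of a state. [folklore] -/
def regs (s : St) : Regs R
  | .inp => s.inp
  | .g1 => s.g1
  | .g2 => s.g2
  | .g => s.g
  | .nU => s.nU
  | .nB => s.nB
  | .n1B => s.n1B
  | .mU => s.mU
  | .NU => s.NU
  | .x => s.x
  | .LU => s.LU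
  | .lc => s.lc
  | .k1 => s.k1
  | .sB => s.sB
  | .s1 => s.s1
  | .s2 => s.s2
  | .sfU => s.sfU
  | .wa => s.wa
  | .w1 => s.w1
  | .w2 => s.w2
  | .f1 => s.f1
  | .iC => s.iC
  | .iF => s.iF
  | .cU => s.cU
  | .SU => s.SU
  | .t3 => s.t3
  | .o => s.o
  | .res => s.res
  | .pl => s.pl
  | .t => s.t
  | .t2 => s.t2
  | .fl => s.fl

section Lemmas
variable (s : St) (v : List Bool)

/-- Reading `inp`. [folklore] -/ @[simp] theorem regs_inp : s.regs .inp = s.inp := rfl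
/-- Reading `g1`. [folklore] -/ @[simp] theorem regs_g1 : s.regs .g1 = s.g1 := rfl
/-- Reading `g2`. [folklore] -/ @[simp] theorem regs_g2 : s.regs .g2 = s.g2 := rfl
/-- Reading `g`. [folklore] -/ @[simp] theorem regs_g : s.regs .g = s.g := rfl
/-- Reading `nU`. [folklore] -/ @[simp] theorem regs_nU : s.regs .nU = s.nU := rfl
/-- Reading `nB`. [folklore] -/ @[simp] theorem regs_nB : s.regs .nB = s.nB := rfl
/-- Reading `n1B`. [folklore] -/ @[simp] theorem regs_n1B : s.regs .n1B = s.n1B := rfl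
/-- Reading `mU`. [folklore] -/ @[simp] theorem regs_mU : s.regs .mU = s.mU := rfl
/-- Reading `NU`. [folklore] -/ @[simp] theorem regs_NU : s.regs .NU = s.NU := rfl
/-- Reading `x`. [folklore] -/ @[simp] theorem regs_x : s.regs .x = s.x := rfl
/-- Reading `LU`. [folklore] -/ @[simp] theorem regs_LU : s.regs .LU = s.LU := rfl
/-- Reading `lc`. [folklore] -/ @[simp] theorem regs_lc : s.regs .lc = s.lc := rfl
/-- Reading `k1`. [folklore] -/ @[simp] theorem regs_k1 : s.regs .k1 = s.k1 := rfl
/-- Reading `sB`. [folklore] -/ @[simp] theorem regs_sB : s.regs .sB = s.sB := rfl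
/-- Reading `s1`. [folklore] -/ @[simp] theorem regs_s1 : s.regs .s1 = s.s1 := rfl
/-- Reading `s2`. [folklore] -/ @[simp] theorem regs_s2 : s.regs .s2 = s.s2 := rfl
/-- Reading `sfU`. [folklore] -/ @[simp] theorem regs_sfU : s.regs .sfU = s.sfU := rfl
/-- Reading `wa`. [folklore] -/ @[simp] theorem regs_wa : s.regs .wa = s.wa := rfl
/-- Reading `w1`. [folklore] -/ @[simp] theorem regs_w1 : s.regs .w1 = s.w1 := rfl
/-- Reading `w2`. [folklore] -/ @[simp] theorem regs_w2 : s.regs .w2 = s.w2 := rfl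
/-- Reading `f1`. [folklore] -/ @[simp] theorem regs_f1 : s.regs .f1 = s.f1 := rfl
/-- Reading `iC`. [folklore] -/ @[simp] theorem regs_iC : s.regs .iC = s.iC := rfl
/-- Reading `iF`. [folklore] -/ @[simp] theorem regs_iF : s.regs .iF = s.iF := rfl
/-- Reading `cU`. [folklore] -/ @[simp] theorem regs_cU : s.regs .cU = s.cU := rfl
/-- Reading `SU`. [folklore] -/ @[simp] theorem regs_SU : s.regs .SU = s.SU := rfl
/-- Reading `t3`. [folklore] -/ @[simp] theorem regs_t3 : s.regs .t3 = s.t3 := rfl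
/-- Reading `o`. [folklore] -/ @[simp] theorem regs_o : s.regs .o = s.o := rfl
/-- Reading `res`. [folklore] -/ @[simp] theorem regs_res : s.regs .res = s.res := rfl
/-- Reading `pl`. [folklore] -/ @[simp] theorem regs_pl : s.regs .pl = s.pl := rfl
/-- Reading `t`. [folklore] -/ @[simp] theorem regs_t : s.regs .t = s.t := rfl
/-- Reading `t2`. [folklore] -/ @[simp] theorem regs_t2 : s.regs .t2 = s.t2 := rfl
/-- Reading `fl`. [folklore] -/ @[simp] theorem regs_fl : s.regs .fl = s.fl := rfl
/-- Writing `inp`. [folklore] -/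
theorem upd_inp : Function.update s.regs .inp v = { s with inp := v }.regs := by
  funext i; cases i <;> rfl
/-- Writing `g1`. [folklore] -/
theorem upd_g1 : Function.update s.regs .g1 v = { s with g1 := v }.regs := by
  funext i; cases i <;> rfl
/-- Writing `g2`. [folklore] -/
theorem upd_g2 : Function.update s.regs .g2 v = { s with g2 := v }.regs := by
  funext i; cases i <;> rfl
/-- Writing `g`. [folklore] -/
theorem upd_g : Function.update s.regs .g v = { s with g := v }.regs := by
  funext i; cases i <;> rfl
/-- Writing `nU`. [folklore] -/
theorem upd_nU : Function.update s.regs .nU v = { s with nU := v }.regs := by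
  funext i; cases i <;> rfl
/-- Writing `nB`. [folklore] -/
theorem upd_nB : Function.update s.regs .nB v = { s with nB := v }.regs := by
  funext i; cases i <;> rfl
/-- Writing `n1B`. [folklore] -/
theorem upd_n1B : Function.update s.regs .n1B v = { s with n1B := v }.regs := by
  funext i; cases i <;> rfl
/-- Writing `mU`. [folklore] -/
theorem upd_mU : Function.update s.regs .mU v = { s with mU := v }.regs := by
  funext i; cases i <;> rfl
/-- Writing `NU`. [folklore] -/
theorem upd_NU : Function.update s.regs .NU v = { s with NU := v }.regs := by
  funext i; cases i <;> rfl
/-- Writing `x`. [folklore] -/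
theorem upd_x : Function.update s.regs .x v = { s with x := v }.regs := by
  funext i; cases i <;> rfl
/-- Writing `LU`. [folklore] -/
theorem upd_LU : Function.update s.regs .LU v = { s with LU := v }.regs := by
  funext i; cases i <;> rfl
/-- Writing `lc`. [folklore] -/
theorem upd_lc : Function.update s.regs .lc v = { s with lc := v }.regs := by
  funext i; cases i <;> rfl
/-- Writing `k1`. [folklore] -/
theorem upd_k1 : Function.update s.regs .k1 v = { s with k1 := v }.regs := by
  funext i; cases i <;> rfl
/-- Writing `sB`. [folklore] -/
theorem upd_sB : Function.update s.regs .sB v = { s with sB := v }.regs := by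
  funext i; cases i <;> rfl
/-- Writing `s1`. [folklore] -/
theorem upd_s1 : Function.update s.regs .s1 v = { s with s1 := v }.regs := by
  funext i; cases i <;> rfl
/-- Writing `s2`. [folklore] -/
theorem upd_s2 : Function.update s.regs .s2 v = { s with s2 := v }.regs := by
  funext i; cases i <;> rfl
/-- Writing `sfU`. [folklore] -/
theorem upd_sfU : Function.update s.regs .sfU v = { s with sfU := v }.regs := by
  funext i; cases i <;> rfl
/-- Writing `wa`. [folklore] -/
theorem upd_wa : Function.update s.regs .wa v = { s with wa := v }.regs := by
  funext i; cases i <;> rfl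
/-- Writing `w1`. [folklore] -/
theorem upd_w1 : Function.update s.regs .w1 v = { s with w1 := v }.regs := by
  funext i; cases i <;> rfl
/-- Writing `w2`. [folklore] -/
theorem upd_w2 : Function.update s.regs .w2 v = { s with w2 := v }.regs := by
  funext i; cases i <;> rfl
/-- Writing `f1`. [folklore] -/
theorem upd_f1 : Function.update s.regs .f1 v = { s with f1 := v }.regs := by
  funext i; cases i <;> rfl
/-- Writing `iC`. [folklore] -/
theorem upd_iC : Function.update s.regs .iC v = { s with iC := v }.regs := by
  funext i; cases i <;> rfl
/-- Writing `iF`. [folklore] -/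
theorem upd_iF : Function.update s.regs .iF v = { s with iF := v }.regs := by
  funext i; cases i <;> rfl
/-- Writing `cU`. [folklore] -/
theorem upd_cU : Function.update s.regs .cU v = { s with cU := v }.regs := by
  funext i; cases i <;> rfl
/-- Writing `SU`. [folklore] -/
theorem upd_SU : Function.update s.regs .SU v = { s with SU := v }.regs := by
  funext i; cases i <;> rfl
/-- Writing `t3`. [folklore] -/
theorem upd_t3 : Function.update s.regs .t3 v = { s with t3 := v }.regs := by
  funext i; cases i <;> rfl
/-- Writing `o`. [folklore] -/
theorem upd_o : Function.update s.regs .o v = { s with o := v }.regs := by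
  funext i; cases i <;> rfl
/-- Writing `res`. [folklore] -/
theorem upd_res : Function.update s.regs .res v = { s with res := v }.regs := by
  funext i; cases i <;> rfl
/-- Writing `pl`. [folklore] -/
theorem upd_pl : Function.update s.regs .pl v = { s with pl := v }.regs := by
  funext i; cases i <;> rfl
/-- Writing `t`. [folklore] -/
theorem upd_t : Function.update s.regs .t v = { s with t := v }.regs := by
  funext i; cases i <;> rfl
/-- Writing `t2`. [folklore] -/
theorem upd_t2 : Function.update s.regs .t2 v = { s with t2 := v }.regs := by
  funext i; cases i <;> rfl
/-- Writing `fl`. [folklore] -/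
theorem upd_fl : Function.update s.regs .fl v = { s with fl := v }.regs := by
  funext i; cases i <;> rfl

end Lemmas

/-- The initial state: everything empty but the input. [folklore] -/
def init (z : List Bool) : St where
  inp := z
  g1 := []
  g2 := []
  g := []
  nU := []
  nB := []
  n1B := []
  mU := []
  NU := []
  x := []
  LU := []
  lc := []
  k1 := []
  sB := []
  s1 := []
  s2 := []
  sfU := []
  wa := []
  w1 := []
  w2 := []
  f1 := []
  iC := []
  iF := []
  cU := []
  SU := []
  t3 := []
  o := []
  res := []
  pl := []
  t := []
  t2 := []
  fl := []

/-- The initial state is the initial register file. [folklore] -/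
theorem init_regs (z : List Bool) : (init z).regs = Regs.init R.inp z := by
  funext i; cases i <;> rfl

end St

/-! ### The printed texts -/

/-- The doubled code of a `CZ` gate before its first numeral: tag, symbol `1`, arity `11`.
[cite: AroraBarak2009, §6.1 (descriptions of circuits)] -/
def preCZ : List Bool :=
  [false, false] ++ List.replicate 4 true ++ [false, false, true, true] ++ List.replicate 8 true ++ [false, false, true, true]
/-- The group separator between the two numerals of a `CZ` gate. [folklore] -/
def midSep : List Bool := [false, false, true, true]
/-- The end of a gate code: group separator and pair separator. [folklore] -/
def postSep : List Bool := [false, false, true, true, false, true]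
/-- The doubled code of a `T` gate (symbol `01`) before its numeral. [cite: AroraBarak2009, §6.1] -/
def preT : List Bool :=
  [false, false] ++ List.replicate 4 false ++ List.replicate 4 true ++ [false, false, true, true] ++ List.replicate 4 true ++
    [false, false, true, true]
/-- The doubled code of a `Z` gate (symbol `[]`) before its numeral. [cite: AroraBarak2009, §6.1] -/
def preZ : List Bool := [false, false] ++ [false, false, true, true] ++ List.replicate 4 true ++ [false, false, true, true]

/-- **The printed text of a `CZ` gate** on the wires with numerals `p`, `q` (inside `encList`).
[cite: AroraBarak2009, §6.1 (descriptions of circuits)] -/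
def czText (p q : List Bool) : List Bool := preCZ ++ rep 4 p ++ midSep ++ rep 4 q ++ postSep
/-- **The printed text of a `T` gate** on the wire with numeral `p`. [cite: AroraBarak2009, §6.1] -/
def tText (p : List Bool) : List Bool := preT ++ rep 4 p ++ postSep
/-- **The printed text of a `Z` gate** on the wire with numeral `p`. [cite: AroraBarak2009, §6.1] -/
def zText (p : List Bool) : List Bool := preZ ++ rep 4 p ++ postSep

/-- Length of `czText`. [folklore] -/
@[simp] theorem length_czText (p q : List Bool) : (czText p q).length = 4 * p.length + 4 * q.length + 32 := by
  simp only [czText, preCZ, midSep, postSep, List.length_append, List.length_cons, List.length_nil, List.length_replicate,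
    length_rep]; omega
/-- Length of `tText`. [folklore] -/
@[simp] theorem length_tText (p : List Bool) : (tText p).length = 4 * p.length + 28 := by
  simp only [tText, preT, postSep, List.length_append, List.length_cons, List.length_nil, List.length_replicate, length_rep]
  omega
/-- Length of `zText`. [folklore] -/
@[simp] theorem length_zText (p : List Bool) : (zText p).length = 4 * p.length + 20 := by
  simp only [zText, preZ, postSep, List.length_append, List.length_cons, List.length_nil, List.length_replicate, length_rep]
  omega

/-! ### Printing numerals held in registers -/

/-- The concatenation of the contents of a list of registers (a numeral split over registers:
`L`-bit part, stage part). [folklore] -/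
def cat (s : St) (l : List R) : List Bool := l.flatMap s.regs

/-- `cat` of nil. [folklore] -/
@[simp] theorem cat_nil (s : St) : cat s [] = [] := rfl
/-- `cat` of cons. [folklore] -/
@[simp] theorem cat_cons (s : St) (r : R) (l : List R) : cat s (r :: l) = s.regs r ++ cat s l := rfl

/-- Changing the body register does not change the others. [folklore] -/
theorem St.regs_o_update (s : St) (v : List Bool) {r : R} (hr : r ≠ R.o) :
    ({ s with o := v } : St).regs r = s.regs r := by
  cases r <;> first | rfl | exact absurd rfl hr

/-- `cat` ignores the body register (for lists of other registers). [folklore] -/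
theorem cat_o_update (s : St) (v : List Bool) {l : List R} (hl : R.o ∉ l) : cat { s with o := v } l = cat s l := by
  induction l with
  | nil => rfl
  | cons r l ih =>
    rw [cat_cons, cat_cons, St.regs_o_update _ _ (fun h => hl (by simp [h])), ih (fun h => hl (List.mem_cons_of_mem _ h))]

/-- Print fourfold every bit of the registers of `l`, in order. [folklore] -/
def emitNum : List R → Com R
  | [] => Com.skip
  | r :: l => emitRep r .t .o 4 ;; emitNum l

/-- Registers other than `o` are unchanged by an update of `o` (register-file form). [folklore] -/
theorem regs_update_o_of_ne (s : St) (v : List Bool) {r : R} (hr : r ≠ R.o) : Function.update s.regs R.o v r = s.regs r :=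
  Function.update_of_ne hr _ _

/-- `cat` through an update of `o`. [folklore] -/
theorem flatMap_update_o (s : St) (v : List Bool) {l : List R} (hl : R.o ∉ l) :
    l.flatMap (Function.update s.regs R.o v) = cat s l := by
  induction l with
  | nil => rfl
  | cons r l ih =>
    rw [List.flatMap_cons, cat_cons, regs_update_o_of_ne _ _ (fun h => hl (by simp [h])),
      ih (fun h => hl (List.mem_cons_of_mem _ h))]

/-- **`emitNum l` prints `rep 4 (cat s l)`** (reversed, on top of the body), provided the scratch `t`
is empty and `l` avoids `o`, `t`; cost `10 |cat s l| + 2 |l|`. [folklore] -/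
theorem runs_emitNum : ∀ (l : List R) (_ : R.o ∉ l) (_ : R.t ∉ l) (s : St) (_ : s.t = []),
    Runs (emitNum l) s.regs { s with o := (rep 4 (cat s l)).reverse ++ s.o }.regs (10 * (cat s l).length + 2 * l.length)
  | [], _, _, s, _ => (Runs.skip _).of_eq
      (by rw [cat_nil, rep_nil, List.reverse_nil, List.nil_append, ← St.upd_o]) (by simp)
  | r :: l, hol, htl, s, ht => by
    have hro : r ≠ .o := fun h => hol (by simp [h])
    have hrt : r ≠ .t := fun h => htl (by simp [h])
    have e1 := runs_emitRep hro hrt (by decide) 4 s.regs (by simpa using ht)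
    rw [St.upd_o] at e1
    have e2 := runs_emitNum l (fun h => hol (List.mem_cons_of_mem _ h)) (fun h => htl (List.mem_cons_of_mem _ h))
      { s with o := (rep 4 (s.regs r)).reverse ++ s.o } ht
    rw [cat_o_update _ _ (fun h => hol (List.mem_cons_of_mem _ h))] at e2
    refine (e1.seq e2).of_eq ?_ ?_
    · simp only [cat_cons, rep_append, List.reverse_append, List.append_assoc]
    · simp only [cat_cons, List.length_append, List.length_cons]
      ring_nf; omega

/-- Print a gate code: a literal prefix, numerals, a literal middle, numerals, a literal suffix.
[folklore] -/
def emitCode (pre : List Bool) (P : List R) (mid : List Bool) (Q : List R) (post : List Bool) : Com R :=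
  pushList .o pre ;; emitNum P ;; pushList .o mid ;; emitNum Q ;; pushList .o post

/-- `emitCode` prints `pre ++ rep 4 (cat s P) ++ mid ++ rep 4 (cat s Q) ++ post`. [folklore] -/
theorem runs_emitCode (pre : List Bool) {P : List R} (hPo : R.o ∉ P) (hPt : R.t ∉ P) (mid : List Bool) {Q : List R}
    (hQo : R.o ∉ Q) (hQt : R.t ∉ Q) (post : List Bool) (s : St) (ht : s.t = []) :
    Runs (emitCode pre P mid Q post) s.regs
      { s with o := (pre ++ rep 4 (cat s P) ++ mid ++ rep 4 (cat s Q) ++ post).reverse ++ s.o }.regs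
      (pre.length + (10 * (cat s P).length + 2 * P.length) + mid.length + (10 * (cat s Q).length + 2 * Q.length) + post.length) := by
  have e1 := runs_pushList R.o pre s.regs
  rw [St.upd_o] at e1
  have e2 := runs_emitNum P hPo hPt { s with o := pre.reverse ++ s.o } ht
  rw [cat_o_update _ _ hPo] at e2
  have e3 := runs_pushList R.o mid ({ s with o := (rep 4 (cat s P)).reverse ++ (pre.reverse ++ s.o) } : St).regs
  rw [St.upd_o] at e3
  have e4 := runs_emitNum Q hQo hQt { s with o := mid.reverse ++ ((rep 4 (cat s P)).reverse ++ (pre.reverse ++ s.o)) } ht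
  rw [cat_o_update _ _ hQo] at e4
  have e5 := runs_pushList R.o post
    ({ s with o := (rep 4 (cat s Q)).reverse ++ (mid.reverse ++ ((rep 4 (cat s P)).reverse ++ (pre.reverse ++ s.o))) } : St).regs
  rw [St.upd_o] at e5
  refine (e1.seq (e2.seq (e3.seq (e4.seq e5)))).of_eq ?_ ?_
  · simp only [St.regs_o, List.reverse_append, List.append_assoc]
  · omega

/-- Print the code of `CZ` on the wires whose numerals are split over the registers `P`, `Q`.
[cite: BremnerJozsaShepherdPRSA2011, Thm. 1 (proof, the `CZ_{ae}` of the gadget)] -/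
def emitCZ (P Q : List R) : Com R := emitCode preCZ P midSep Q postSep

/-- **`emitCZ P Q` prints `czText (cat s P) (cat s Q)`.** [folklore] -/
theorem runs_emitCZ {P Q : List R} (hPo : R.o ∉ P) (hPt : R.t ∉ P) (hQo : R.o ∉ Q) (hQt : R.t ∉ Q) (s : St) (ht : s.t = []) :
    Runs (emitCZ P Q) s.regs { s with o := (czText (cat s P) (cat s Q)).reverse ++ s.o }.regs
      (10 * (cat s P).length + 10 * (cat s Q).length + 2 * P.length + 2 * Q.length + 32) := by
  refine (runs_emitCode preCZ hPo hPt midSep hQo hQt postSep s ht).of_eq (by rfl) ?_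
  simp only [preCZ, midSep, postSep, List.length_append, List.length_cons, List.length_nil, List.length_replicate]; omega

/-- Print the code of `T` on the wire whose numeral is split over the registers `P`. [cite: NielsenChuang2010, §4.2] -/
def emitT (P : List R) : Com R := emitCode preT P [] [] postSep

/-- **`emitT P` prints `tText (cat s P)`.** [folklore] -/
theorem runs_emitT {P : List R} (hPo : R.o ∉ P) (hPt : R.t ∉ P) (s : St) (ht : s.t = []) :
    Runs (emitT P) s.regs { s with o := (tText (cat s P)).reverse ++ s.o }.regs (10 * (cat s P).length + 2 * P.length + 28) := by
  refine (runs_emitCode preT hPo hPt [] (Q := []) (by simp) (by simp) postSep s ht).of_eq ?_ ?_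
  · simp [tText]
  · simp only [preT, postSep, List.length_append, List.length_cons, List.length_nil, List.length_replicate, cat_nil]; omega

/-- Print the code of `Z` on the wire whose numeral is split over the registers `P`. [cite: NielsenChuang2010, §4.2] -/
def emitZ (P : List R) : Com R := emitCode preZ P [] [] postSep

/-- **`emitZ P` prints `zText (cat s P)`.** [folklore] -/
theorem runs_emitZ {P : List R} (hPo : R.o ∉ P) (hPt : R.t ∉ P) (s : St) (ht : s.t = []) :
    Runs (emitZ P) s.regs { s with o := (zText (cat s P)).reverse ++ s.o }.regs (10 * (cat s P).length + 2 * P.length + 20) := by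
  refine (runs_emitCode preZ hPo hPt [] (Q := []) (by simp) (by simp) postSep s ht).of_eq ?_ ?_
  · simp [zText]
  · simp only [preZ, postSep, List.length_append, List.length_cons, List.length_nil, List.length_replicate, cat_nil]; omega

/-! ### The fixed-width increment -/

/-- The carry pass keeps the length. [cite: KnuthTAOCP2, §4.3.1] -/
@[simp] theorem length_ib : ∀ (c : Bool) (w : List Bool), (TokConv.ib c w).length = w.length
  | _, [] => rfl
  | c, b :: w => by rw [TokConv.ib, List.length_cons, List.length_cons, length_ib]

/-- **Fixed-width increment** of the numeral register `r` (least significant bit on top): the carry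
pass of `incLoop`, the final carry discarded (scratch `t`, flag `fl`). [cite: KnuthTAOCP2, §4.3.1] -/
def incF (r : R) : Com R := Com.push .fl true ;; incLoop r .t .fl ;; clearFlag .fl ;; Com.pour .t r

/-- **`incF r` replaces the contents `w` of `r` by `TokConv.ib true w`** (same length), in `9|w| + 5`
steps, provided `t` and `fl` are empty. [cite: KnuthTAOCP2, §4.3.1] -/
theorem runs_incF {r : R} (hrt : r ≠ .t) (hrf : r ≠ .fl) (s : St) (ht : s.t = []) (hf : s.fl = []) :
    Runs (incF r) s.regs (Function.update s.regs r (TokConv.ib true (s.regs r))) (9 * (s.regs r).length + 5) := by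
  set w := s.regs r with hw
  have h0 : Runs (Com.push .fl true) s.regs (Function.update s.regs .fl (flag true)) 1 := Runs.push' (by simp [hf])
  have h1 := runs_incLoop hrt hrf (by decide) w true (Function.update s.regs .fl (flag true)) (by simp [hrf, hw]) (by simp)
  set R₁ := Function.update (Function.update (Function.update (Function.update s.regs .fl (flag true)) r []) .t
    ((TokConv.ib true w).reverse ++ Function.update s.regs .fl (flag true) .t)) .fl (flag (TokConv.co true w)) with hR₁
  have h2 := runs_clearFlag R.fl R₁ (TokConv.co true w) (by simp [hR₁])
  have h3 := runs_pour (a := R.t) (b := r) hrt.symm (Function.update R₁ .fl [])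
  refine (h0.seq (h1.seq (h2.seq h3))).of_eq ?_ ?_
  · ext i : 1
    simp only [hR₁, Function.update_apply, St.regs_t, ht]
    split_ifs <;> simp_all
  · simp only [hR₁, Function.update_apply, St.regs_t, ht]
    simp
    omega

/-! ### Loops on the unary countdown `cU` -/

/-- The countdown loop on `cU` with the same body whatever the popped bit. [folklore] -/
def loopCU (body : Com R) : Com R := Com.loop .cU body body

/-- Setting `cU` to its own value. [folklore] -/
theorem set_cU_self (s : St) : ({ s with cU := s.cU } : St) = s := by cases s; rfl

/-- Setting `cU` twice. [folklore] -/
theorem set_cU_set_cU (s : St) (v v' : List Bool) : ({ ({ s with cU := v } : St) with cU := v' } : St) = { s with cU := v' } := rfl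

/-- Iterating a map that commutes with setting `cU`. [folklore] -/
theorem iterate_set_cU {f : St → St} (hf : ∀ s v, f { s with cU := v } = { f s with cU := v }) :
    ∀ (k : ℕ) (s : St) (v : List Bool), f^[k] { s with cU := v } = { f^[k] s with cU := v }
  | 0, _, _ => rfl
  | k + 1, s, v => by rw [Function.iterate_succ_apply, Function.iterate_succ_apply, hf, iterate_set_cU hf k]

/-- **The countdown loop.** If the body realises `f` on every state satisfying the invariant `P` in
`C` steps, `f` preserves `P`, and `f` neither reads nor writes `cU`, then on `cU = 1ʲ` the loop
realises `f^[j]` (and empties `cU`) in `j (C + 2) + 1` steps. [cite: AroraBarak2009, §1.3 (bounded loops; polynomial time closed under composition)] -/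
theorem runs_loopCU {body : Com R} {f : St → St} {P : St → Prop} {C : ℕ}
    (hf : ∀ s v, f { s with cU := v } = { f s with cU := v }) (hfix : ∀ s, (f s).cU = s.cU)
    (hPc : ∀ s v, P s → P { s with cU := v }) (hPf : ∀ s, P s → P (f s))
    (hbody : ∀ s, P s → Runs body s.regs (f s).regs C) :
    ∀ (j : ℕ) (s : St), s.cU = List.replicate j true → P s →
      Runs (loopCU body) s.regs { f^[j] s with cU := [] }.regs (j * (C + 2) + 1)
  | 0, s, hs, _ => by
    have hs' : s.cU = [] := hs
    refine (Runs.loop_nil _ _ (show s.regs R.cU = [] from hs')).of_eq ?_ (by simp)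
    rw [Function.iterate_zero, id]
    cases s; simp only at hs'; subst hs'; rfl
  | j + 1, s, hs, hP => by
    have hk : s.regs R.cU = true :: List.replicate j true := hs
    have hb := hbody { s with cU := List.replicate j true } (hPc _ _ hP)
    rw [← St.upd_cU] at hb
    have hih := runs_loopCU hf hfix hPc hPf hbody j (f { s with cU := List.replicate j true })
      (by rw [hfix]) (hPf _ (hPc _ _ hP))
    refine (Runs.loop_true hk hb hih).of_eq ?_ (by ring_nf; omega)
    rw [← Function.iterate_succ_apply, iterate_set_cU hf, set_cU_set_cU]

/-- The `L`-bit zero and its fixed-width successors: the contents of the fixed-width counter after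
`i` increments (`numF L i`; that this is the `L`-bit numeral of `i < 2^L` is proved where it is used).
[cite: KnuthTAOCP2, §4.3.1] -/
def numF (L i : ℕ) : List Bool := (TokConv.ib true)^[i] (List.replicate L false)

/-- `numF` has length `L`. [folklore] -/
@[simp] theorem length_numF (L : ℕ) : ∀ i, (numF L i).length = L
  | 0 => by simp [numF]
  | i + 1 => by rw [numF, Function.iterate_succ_apply', length_ib]; exact length_numF L i

/-- `numF L (i + 1)` is the carry pass of `numF L i`. [folklore] -/
theorem numF_succ (L i : ℕ) : numF L (i + 1) = TokConv.ib true (numF L i) := by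
  rw [numF, Function.iterate_succ_apply']; rfl

/-- **Reset the fixed-width counter**: `iF := 0^L` (`L = |LU|`), through the countdown `cU` (scratch
`t`, `t2`). [folklore] -/
def mkZeroF : Com R := Com.clear .iF ;; Com.clear .cU ;; Com.copy .LU .cU .t .t2 ;; loopCU (Com.push .iF false)

/-- Effect of `mkZeroF`: `iF := 0^{|LU|}`, `cU := []`. [folklore] -/
theorem runs_mkZeroF (s : St) (L : ℕ) (hLU : s.LU = List.replicate L true) (ht : s.t = []) (ht2 : s.t2 = []) :
    Runs mkZeroF s.regs { s with iF := List.replicate L false, cU := [] }.regs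
      (2 * s.iF.length + 2 * s.cU.length + 13 * L + 6) := by
  have e1 := runs_clear R.iF s.regs
  rw [St.upd_iF] at e1
  have e2 := runs_clear R.cU ({ s with iF := [] } : St).regs
  rw [St.upd_cU] at e2
  have e3 := runs_copy (a := R.LU) (b := R.cU) (t := R.t) (u := R.t2) (by decide) (by decide) (by decide) (by decide)
    (by decide) (by decide) ({ s with iF := [], cU := [] } : St).regs (by simpa using ht) (by simpa using ht2)
  rw [St.upd_cU] at e3
  simp only [St.regs_LU, St.regs_cU, List.append_nil] at e3
  have e4 := runs_loopCU (body := Com.push .iF false) (f := fun s : St => { s with iF := false :: s.iF }) (P := fun _ => True)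
    (C := 1) (fun _ _ => rfl) (fun _ => rfl) (fun _ _ _ => trivial) (fun _ _ => trivial)
    (fun s _ => (Runs.push R.iF false s.regs).of_eq (by rw [St.upd_iF]; rfl) le_rfl) L
    ({ s with iF := [], cU := s.LU } : St) hLU trivial
  have hit : ∀ (k : ℕ) (s : St), (fun s : St => { s with iF := false :: s.iF })^[k] s = { s with iF := List.replicate k false ++ s.iF } := by
    intro k; induction k with
    | zero => intro s; rfl
    | succ k ih => intro s; rw [Function.iterate_succ_apply', ih, List.replicate_succ]; rfl
  rw [hit] at e4
  refine (e1.seq (e2.seq (e3.seq e4))).of_eq ?_ ?_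
  · simp
  · simp only [St.regs_iF, St.regs_cU, hLU, List.length_replicate]; omega

/-! ### The hop layer -/

/-- **The printed text of a hop layer**: `CZ(pos s i, pos s' i)` for `i < N`, each position printed as
the `L`-bit counter followed by a stage numeral (`u` for `s`, `v` for `s'`).
[cite: BremnerJozsaShepherdPRSA2011, Thm. 1 (proof, Fig. 1)] -/
def hopText (L N : ℕ) (u v : List Bool) : List Bool :=
  (List.range N).flatMap fun i => czText (numF L i ++ u) (numF L i ++ v)

/-- `hopText` with one more line. [folklore] -/
theorem hopText_succ (L N : ℕ) (u v : List Bool) :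
    hopText L (N + 1) u v = hopText L N u v ++ czText (numF L N ++ u) (numF L N ++ v) := by
  rw [hopText, List.range_succ, List.flatMap_append, List.flatMap_singleton]; rfl

/-- Length of `hopText`. [folklore] -/
theorem length_hopText (L N : ℕ) (u v : List Bool) : (hopText L N u v).length = N * (8 * L + 4 * u.length + 4 * v.length + 32) := by
  induction N with
  | zero => simp [hopText]
  | succ N ih => rw [hopText_succ, List.length_append, ih, length_czText]; simp; ring

/-- The body of the hop loop: print one `CZ` and increment the counter. [folklore] -/
def hopBody (sa sb : R) : Com R := emitCZ [.iF, sa] [.iF, sb] ;; incF .iF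

/-- **The hop layer** between the stages whose numerals are in `sa`, `sb`: reset the counter, load
the countdown with `N`, print `N` gates. [cite: BremnerJozsaShepherdPRSA2011, Thm. 1 (proof, Fig. 1)] -/
def hopLayer (sa sb : R) : Com R := mkZeroF ;; Com.copy .NU .cU .t .t2 ;; loopCU (hopBody sa sb)

/-- Model of the hop body. [folklore] -/
def hopBodyM (sa sb : R) (s : St) : St :=
  { s with o := (czText (s.iF ++ s.regs sa) (s.iF ++ s.regs sb)).reverse ++ s.o, iF := TokConv.ib true s.iF }

/-- A stage register: not `o`, `t`, `iF`, `cU`, `fl`. [folklore] -/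
def StageReg (r : R) : Prop := r ≠ .o ∧ r ≠ .t ∧ r ≠ .iF ∧ r ≠ .cU ∧ r ≠ .fl

/-- The hop body runs to its model. [folklore] -/
theorem runs_hopBody {sa sb : R} (ha : StageReg sa) (hb : StageReg sb) (s : St) (ht : s.t = []) (hf : s.fl = []) :
    Runs (hopBody sa sb) s.regs (hopBodyM sa sb s).regs
      (10 * (s.iF.length + (s.regs sa).length) + 10 * (s.iF.length + (s.regs sb).length) + 9 * s.iF.length + 45) := by
  obtain ⟨hao, hat, hai, -, haf⟩ := ha
  obtain ⟨hbo, hbt, hbi, -, hbf⟩ := hb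
  have e1 := runs_emitCZ (P := [.iF, sa]) (Q := [.iF, sb]) (by simp [hao.symm]) (by simp [hat.symm]) (by simp [hbo.symm])
    (by simp [hbt.symm]) s ht
  set s1 : St := { s with o := (czText (cat s [.iF, sa]) (cat s [.iF, sb])).reverse ++ s.o } with hs1
  have e2 := runs_incF (r := R.iF) (by decide) (by decide) s1 ht hf
  rw [St.upd_iF] at e2
  refine (e1.seq e2).of_eq ?_ ?_
  · simp only [hs1, hopBodyM, cat_cons, cat_nil, List.append_nil, St.regs_iF]
  · simp only [cat_cons, cat_nil, List.append_nil, List.length_append, St.regs_iF, hs1, List.length_cons, List.length_nil]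
    omega

/-- The hop body commutes with setting `cU`. [folklore] -/
theorem hopBodyM_set_cU {sa sb : R} (ha : StageReg sa) (hb : StageReg sb) (s : St) (v : List Bool) :
    hopBodyM sa sb { s with cU := v } = { hopBodyM sa sb s with cU := v } := by
  obtain ⟨-, -, -, hac, -⟩ := ha
  obtain ⟨-, -, -, hbc, -⟩ := hb
  have h1 : ({ s with cU := v } : St).regs sa = s.regs sa := by cases sa <;> first | rfl | exact absurd rfl hac
  have h2 : ({ s with cU := v } : St).regs sb = s.regs sb := by cases sb <;> first | rfl | exact absurd rfl hbc
  simp only [hopBodyM, h1, h2]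

/-- Iterating the hop body prints the hop text and counts. [folklore] -/
theorem hopBodyM_iterate {sa sb : R} (ha : StageReg sa) (hb : StageReg sb) (L : ℕ) :
    ∀ (k : ℕ) (s : St), s.iF = List.replicate L false →
      (hopBodyM sa sb)^[k] s = { s with o := (hopText L k (s.regs sa) (s.regs sb)).reverse ++ s.o, iF := numF L k }
  | 0, s, h => by simp [hopText, numF, ← h]
  | k + 1, s, h => by
    have hao := ha.1; have hai := ha.2.2.1; have hbo := hb.1; have hbi := hb.2.2.1
    rw [Function.iterate_succ_apply', hopBodyM_iterate ha hb L k s h, hopBodyM, hopText_succ, numF_succ]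
    have h1 : ∀ (x y : List Bool), ({ s with o := x, iF := y } : St).regs sa = s.regs sa := by
      intro x y; cases sa <;> first | rfl | exact absurd rfl hao | exact absurd rfl hai
    have h2 : ∀ (x y : List Bool), ({ s with o := x, iF := y } : St).regs sb = s.regs sb := by
      intro x y; cases sb <;> first | rfl | exact absurd rfl hbo | exact absurd rfl hbi
    simp only [h1, h2, List.reverse_append, List.append_assoc]

/-- **The hop layer prints `hopText`** (and leaves the counter at `numF L N`, the countdown empty),
provided `LU = 1ᴸ`, `NU = 1ᴺ`, the scratch registers and the carry flag are empty.
[cite: BremnerJozsaShepherdPRSA2011, Thm. 1 (proof, Fig. 1)] -/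
theorem runs_hopLayer {sa sb : R} (ha : StageReg sa) (hb : StageReg sb) (s : St) (L N : ℕ)
    (hLU : s.LU = List.replicate L true) (hNU : s.NU = List.replicate N true) (ht : s.t = []) (ht2 : s.t2 = [])
    (hf : s.fl = []) :
    Runs (hopLayer sa sb) s.regs
      { s with o := (hopText L N (s.regs sa) (s.regs sb)).reverse ++ s.o, iF := numF L N, cU := [] }.regs
      (2 * s.iF.length + 2 * s.cU.length + 13 * L + 6 + (10 * N + 3) +
        (N * (10 * (L + (s.regs sa).length) + 10 * (L + (s.regs sb).length) + 9 * L + 45 + 2) + 1)) := by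
  have hao := ha.1; have hai := ha.2.2.1; have hac := ha.2.2.2.1
  have hbo := hb.1; have hbi := hb.2.2.1; have hbc := hb.2.2.2.1
  have e1 := runs_mkZeroF s L hLU ht ht2
  set s1 : St := { s with iF := List.replicate L false, cU := [] } with hs1
  have e2 := runs_copy (a := R.NU) (b := R.cU) (t := R.t) (u := R.t2) (by decide) (by decide) (by decide) (by decide)
    (by decide) (by decide) s1.regs (by simpa [hs1] using ht) (by simpa [hs1] using ht2)
  rw [St.upd_cU] at e2
  simp only [hs1, St.regs_NU, St.regs_cU, List.append_nil] at e2
  set s2 : St := { s with iF := List.replicate L false, cU := s.NU } with hs2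
  -- the invariant of the loop: sizes and emptiness
  have e3 := runs_loopCU (body := hopBody sa sb) (f := hopBodyM sa sb)
    (P := fun x : St => x.t = [] ∧ x.fl = [] ∧ x.iF.length = L ∧ x.regs sa = s.regs sa ∧ x.regs sb = s.regs sb)
    (C := 10 * (L + (s.regs sa).length) + 10 * (L + (s.regs sb).length) + 9 * L + 45)
    (hopBodyM_set_cU ha hb) (fun _ => rfl)
    (fun x v ⟨h1, h2, h3, h4, h5⟩ => ⟨h1, h2, h3,
      by rw [← h4]; cases sa <;> first | rfl | exact absurd rfl hac,
      by rw [← h5]; cases sb <;> first | rfl | exact absurd rfl hbc⟩)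
    (fun x ⟨h1, h2, h3, h4, h5⟩ => ⟨h1, h2, by rw [hopBodyM, length_ib]; exact h3,
      by rw [← h4, hopBodyM]; cases sa <;> first | rfl | exact absurd rfl hao | exact absurd rfl hai,
      by rw [← h5, hopBodyM]; cases sb <;> first | rfl | exact absurd rfl hbo | exact absurd rfl hbi⟩)
    (fun x ⟨h1, h2, h3, h4, h5⟩ => (runs_hopBody ha hb x h1 h2).of_eq rfl (by rw [h3, h4, h5]))
    N s2 (by simp [hs2, hNU]) ⟨by simpa [hs2] using ht, by simpa [hs2] using hf, by simp [hs2],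
      by cases sa <;> first | rfl | exact absurd rfl hai | exact absurd rfl hac,
      by cases sb <;> first | rfl | exact absurd rfl hbi | exact absurd rfl hbc⟩
  rw [hopBodyM_iterate ha hb L N s2 (by simp [hs2])] at e3
  have hsa : s2.regs sa = s.regs sa := by cases sa <;> first | rfl | exact absurd rfl hai | exact absurd rfl hac
  have hsb : s2.regs sb = s.regs sb := by cases sb <;> first | rfl | exact absurd rfl hbi | exact absurd rfl hbc
  rw [hsa, hsb] at e3
  refine (e1.seq (e2.seq e3)).of_eq ?_ (by rw [hNU, List.length_replicate]; exact le_of_eq (by ring))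
  simp [hs2]

end Asm

end HGadget.Hop

end Literature.Computability.QuantumComplexity
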